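import Mathlib
import HarnessLib
import Summits.Parity.BatemanHorn.Theses.RoughValueTransport
import Summits.Parity.BatemanHorn.Theorems.RoughValueTransportSieveCalibration
import Summits.Parity.BatemanHorn.Theorems.RoughValueTransportRoughValueLawOmegaFacts
import Summits.Parity.BatemanHorn.Theorems.RoughValueTransportBalancedSemiprimeLayerDegreeLeTwo
import Summits.Parity.BatemanHorn.Theorems.RoughValueTransportAssembly
import Summits.Parity.BatemanHorn.Theorems.BalancedSemiprimeLayer.Negative.LowerHalf
import Literature.NumberTheory.Sieve.BuchstabLimitFact
import Literature.NumberTheory.Sieve.BatemanHornProofs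
import Literature.NumberTheory.Sieve.AletheiaZomleferFukshanskyGarcia2020Applications

/-!
# STRATEGY CENSUS (gen 1) — typed companion for crux stmt-Parity-11390 `RoughValueTransport.RoughValueLaw`

Strategist work file (planner-cstrat-stmt-Parity-11390-s1-0, 2026-08-17), companion of
`Cruxes/RoughValueLaw/STRATEGY-CENSUS.md` Part I (gen 1). No `sorry`. It records, as elaborated Lean,
the NEW typed objects of the gen-1 census (the gen-0 objects D1/D4/D5 live in `STRATEGY_CENSUS.lean`):

* §D8 — the ONE-SIDED split `UpperRVL ∧ LowerRVL ↔ RoughValueLaw` (constant pinned to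
  `C(f)/∏ deg fᵢ`; glue and converse kernel-checked: `roughValueLaw_iff_upper_and_lower`), and the
  kernel-checked reason the LOWER half alone is summit-class: `twinPrimes_of_lowerRVL`
  (lower half at the twin system + the PROVED degree-≤2 layer ⇒ `π₂(x) → ∞`), and the reason the
  UPPER half alone is beyond every upper-bound sieve: `sharpUpper_of_upperRVL` (upper half ⇒ the
  factor-ONE Bateman–Horn upper bound `P_f(x) ≤ (C(f)/∏deg + ε)x/(log x)^k` for every system of every
  degree — below the parity floor 2 of dimension-one upper-bound sieves);
* §S-A — the multi-depth strengthening `MultiDepthRVL` (independent depths `uᵢ`, product shape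
  `∏ uᵢω(uᵢ)`) and the diagonal specialisation `roughValueLaw_of_multiDepth`;
* §D9 — the Tauberian split in the variable `t = log log x`: leaves `LogLogMeanRVL` (log-log Cesàro mean)
  and `PowerScaleRegular` (slow oscillation across power scales), typed only (the glue is R. Schmidt's
  slow-oscillation Tauberian theorem, not formalised here; see the census for why neither leaf has a tool).

Nothing here is filed as an item; the census explains why none of these splits is executed.
-/

noncomputable section

open Filter Finset Polynomial
open scoped Topology BigOperators

namespace Summit.Parity.BatemanHorn.Cruxes.RoughValueLaw.CensusS1

open Literature.NumberTheory.Sieve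
open Summit.Parity.BatemanHorn.Theses.RoughValueTransport (RoughValueLaw)
open Summit.Parity.BatemanHorn.Theorems (sieveCalibration_proof)
open Summit.Parity.BatemanHorn.Cruxes.RoughValueLaw.IncrementAnchoring (OmegaFacts.eq_buchstabOmega)
open Summit.Parity.BatemanHorn.Cruxes.BalancedSemiprimeLayer.SmoothModulusTwistedHooley
  (layerConclusion_of_natDegree_le_two)

/-- The inline Buchstab predicate of the crux. -/
def IsBuchstab (ω : ℝ → ℝ) : Prop :=
  (∀ u : ℝ, 1 ≤ u → u ≤ 2 → ω u = u⁻¹) ∧ ContinuousOn ω (Set.Ici 1) ∧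
    (∀ u : ℝ, 2 < u → HasDerivAt (fun t : ℝ => t * ω t) (ω (u - 1)) u)

theorem isBuchstab_buchstabOmega : IsBuchstab buchstabOmega :=
  ⟨fun _ h1 h2 => buchstabOmega_eq_inv h1 h2, continuousOn_buchstabOmega,
    fun _ hu => hasDerivAt_mul_buchstabOmega hu⟩

/-- `Φ_f(x,u) (log x)^k / x`, the crux's normalised rough-value count. -/
def ratio {k : ℕ} (f : Fin k → ℤ[X]) (u : ℝ) (x : ℕ) : ℝ :=
  (((Finset.Icc 1 x).filter (fun n : ℕ => ∀ i, 0 < (f i).eval (n : ℤ) ∧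
    ∀ p ∈ Finset.range ⌈(x : ℝ) ^ (((f i).natDegree : ℝ) / u)⌉₊,
      p.Prime → ¬ ((p : ℤ) ∣ (f i).eval (n : ℤ)))).card : ℝ) * Real.log x ^ k / (x : ℝ)

/-- The forced constant `A_f = C(f)/∏ deg fᵢ` (forced by the PROVED `sieveCalibration_proof`). -/
def bhA {k : ℕ} (f : Fin k → ℤ[X]) : ℝ :=
  batemanHornConst f / ∏ i, ((f i).natDegree : ℝ)

theorem roughValueLaw_iff :
    RoughValueLaw ↔ ∀ (k : ℕ) (f : Fin k → ℤ[X]), IsBatemanHornSystem f →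
      ∀ ω, IsBuchstab ω → ∃ A : ℝ, ∀ u : ℝ, 2 < u →
        Tendsto (ratio f u) atTop (𝓝 (A * (u * ω u) ^ k)) :=
  Iff.rfl

/-! ### Calibration: in the crux's conclusion the constant is forced to be `bhA f` -/

/-- If the rung law holds for a Bateman–Horn system `f`, a Buchstab `ω` and SOME constant `A` at every
`u > 2`, then `A = C(f)/∏ deg fᵢ` (PROVED calibration `sieveCalibration_proof` + de Bruijn's
`ω(u) → e^{−γ}` + uniqueness of `ω`). [folklore] -/
theorem const_eq_bhA {k : ℕ} {f : Fin k → ℤ[X]} (hf : IsBatemanHornSystem f) {ω : ℝ → ℝ}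
    (hω : IsBuchstab ω) {A : ℝ}
    (hA : ∀ u : ℝ, 2 < u → Tendsto (ratio f u) atTop (𝓝 (A * (u * ω u) ^ k))) :
    A = bhA f := by
  have hS := sieveCalibration_proof k f hf (fun u => A * (u * ω u) ^ k)
    ⟨3, fun u hu => hA u (by linarith)⟩
  have hωeq : ∀ u : ℝ, 1 ≤ u → ω u = buchstabOmega u :=
    fun u hu => OmegaFacts.eq_buchstabOmega hω.1 hω.2.1 hω.2.2 hu
  have hdB := harman2007_buchstabOmega_tendsto_holds
  unfold harman2007_buchstabOmega_tendsto at hdB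
  have hlim : Tendsto (fun u : ℝ => A * (u * ω u) ^ k / u ^ k) atTop
      (𝓝 (A * Real.exp (-Real.eulerMascheroniConstant) ^ k)) := by
    have h1 := (hdB.pow k).const_mul A
    refine h1.congr' ?_
    filter_upwards [eventually_ge_atTop 1] with u hu
    have hu0 : u ≠ 0 := by linarith
    rw [hωeq u hu, mul_pow]
    field_simp
  have huniq := tendsto_nhds_unique hlim hS
  have he : Real.exp (-((k : ℝ) * Real.eulerMascheroniConstant)) =
      Real.exp (-Real.eulerMascheroniConstant) ^ k := by
    rw [← Real.exp_nat_mul]; congr 1; ring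
  rw [he] at huniq
  unfold bhA
  exact mul_right_cancel₀ (pow_ne_zero k (Real.exp_pos _).ne') huniq

/-! ### §D8 — the one-sided split: UPPER ∧ LOWER -/

/-- Leaf U: the sharp UPPER rung law (constant pinned). -/
def UpperRVL : Prop :=
  ∀ (k : ℕ) (f : Fin k → ℤ[X]), IsBatemanHornSystem f → ∀ ω, IsBuchstab ω →
    ∀ u : ℝ, 2 < u → ∀ ε : ℝ, 0 < ε →
      ∀ᶠ x : ℕ in atTop, ratio f u x ≤ bhA f * (u * ω u) ^ k + ε

/-- Leaf L: the sharp LOWER rung law (constant pinned). -/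
def LowerRVL : Prop :=
  ∀ (k : ℕ) (f : Fin k → ℤ[X]), IsBatemanHornSystem f → ∀ ω, IsBuchstab ω →
    ∀ u : ℝ, 2 < u → ∀ ε : ℝ, 0 < ε →
      ∀ᶠ x : ℕ in atTop, bhA f * (u * ω u) ^ k - ε ≤ ratio f u x

/-- Glue of §D8 (squeeze). -/
theorem roughValueLaw_of_upper_of_lower (hU : UpperRVL) (hL : LowerRVL) : RoughValueLaw := by
  rw [roughValueLaw_iff]
  intro k f hf ω hω
  refine ⟨bhA f, fun u hu => ?_⟩
  rw [Metric.tendsto_nhds]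
  intro ε hε
  filter_upwards [hU k f hf ω hω u hu (ε / 2) (by positivity),
    hL k f hf ω hω u hu (ε / 2) (by positivity)] with x h1 h2
  rw [Real.dist_eq, abs_lt]
  constructor <;> linarith

/-- Converse of §D8 (the crux gives both halves, by `const_eq_bhA`). -/
theorem upper_and_lower_of_roughValueLaw (h : RoughValueLaw) : UpperRVL ∧ LowerRVL := by
  rw [roughValueLaw_iff] at h
  have key : ∀ (k : ℕ) (f : Fin k → ℤ[X]), IsBatemanHornSystem f → ∀ ω, IsBuchstab ω →
      ∀ u : ℝ, 2 < u → ∀ ε : ℝ, 0 < ε →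
        ∀ᶠ x : ℕ in atTop, dist (ratio f u x) (bhA f * (u * ω u) ^ k) < ε := by
    intro k f hf ω hω u hu ε hε
    obtain ⟨A, hA⟩ := h k f hf ω hω
    have hAeq : A = bhA f := const_eq_bhA hf hω hA
    have := hA u hu
    rw [hAeq, Metric.tendsto_nhds] at this
    exact this ε hε
  constructor
  · intro k f hf ω hω u hu ε hε
    filter_upwards [key k f hf ω hω u hu ε hε] with x hx
    rw [Real.dist_eq, abs_lt] at hx
    linarith [hx.2]
  · intro k f hf ω hω u hu ε hε
    filter_upwards [key k f hf ω hω u hu ε hε] with x hx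
    rw [Real.dist_eq, abs_lt] at hx
    linarith [hx.1]

theorem roughValueLaw_iff_upper_and_lower : RoughValueLaw ↔ UpperRVL ∧ LowerRVL :=
  ⟨upper_and_lower_of_roughValueLaw, fun h => roughValueLaw_of_upper_of_lower h.1 h.2⟩

/-- WHY LEAF L IS SUMMIT-CLASS (kernel-checked): the LOWER half alone, at the twin system and one
shallow depth `u = 2/(1−δ)`, together with the PROVED degree-≤2 layer
(`layerConclusion_of_natDegree_le_two`), forces `π₂(x) ≥ (C₂/…)·x/(log x)² → ∞`, hence the twin
prime conjecture. [folklore] -/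
theorem twinPrimes_of_lowerRVL (hLow : LowerRVL) : TwinPrimeConjecture := by
  -- constants for the twin system
  have hf := isBatemanHornSystem_twinSystem
  obtain ⟨-, hCf0⟩ := IsBatemanHornSystem.hasBatemanHornConst_holds hf
  have hdeg1 : ∀ i, (twinSystem i).natDegree = 1 := by
    intro i
    fin_cases i
    · simp [twinSystem]
    · show ((X : ℤ[X]) + 2).natDegree = 1
      simpa using natDegree_X_add_C (2 : ℤ)
  have hdeg : ∀ i, (twinSystem i).natDegree ≤ 2 := fun i => by rw [hdeg1 i]; omega
  have hD : ∏ i, ((twinSystem i).natDegree : ℝ) = 1 := by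
    simp [hdeg1]
  set C₀ : ℝ := bhA twinSystem with hC₀_def
  have hC₀0 : 0 < C₀ := by
    rw [hC₀_def]; unfold bhA; rw [hD, div_one]; exact hCf0
  -- the layer at ε = C₀/4
  obtain ⟨δ, hδ0, hδ4, hev⟩ :=
    layerConclusion_of_natDegree_le_two 2 twinSystem hf hdeg (C₀ / 4) (by positivity)
  -- the depth u = 2/(1-δ) ∈ (2, 3]
  obtain ⟨u, hu_def⟩ : ∃ u : ℝ, u = 2 / (1 - δ) := ⟨_, rfl⟩
  have h1δ : 0 < 1 - δ := by linarith
  have hu2 : 2 < u := by rw [hu_def, lt_div_iff₀ h1δ]; linarith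
  have hu3 : u ≤ 3 := by rw [hu_def, div_le_iff₀ h1δ]; linarith
  have hexp : ∀ d : ℕ, (d : ℝ) / u = (d : ℝ) * (1 - δ) / 2 := by
    intro d; rw [hu_def]; field_simp
  -- value of the Buchstab factor at u: (u ω(u))² ≥ 1
  have hval : 1 ≤ (u * buchstabOmega u) ^ 2 := by
    rw [buchstabOmega_eq_of_mem_Icc_two_three hu2.le hu3]
    have hu0 : u ≠ 0 := by linarith
    rw [mul_div_cancel₀ _ hu0]
    have hlog : 0 ≤ Real.log (u - 1) := Real.log_nonneg (by linarith)
    nlinarith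
  -- lower half at (twinSystem, buchstabOmega, u, ε = C₀/4)
  have hlow := hLow 2 twinSystem hf buchstabOmega isBuchstab_buchstabOmega u hu2 (C₀ / 4)
    (by positivity)
  -- conclude: twinPrimeCount x ≥ (C₀/2) x/(log x)² eventually, which → ∞
  have hgrow : Tendsto (fun x : ℕ => C₀ / 2 * ((x : ℝ) / Real.log x ^ 2)) atTop atTop :=
    tendsto_natCast_div_log_sq_atTop.const_mul_atTop (by positivity)
  refine twinPrimeConjecture_of_tendsto (tendsto_atTop_mono' atTop ?_ hgrow)
  filter_upwards [hlow, hev, eventually_gt_atTop 1] with x hx hxev hx1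
  have hx' : (1 : ℝ) < x := by exact_mod_cast hx1
  have hlog : 0 < Real.log x := Real.log_pos hx'
  have hx0 : (0 : ℝ) < x := by linarith
  have hpow : 0 < Real.log x ^ 2 := pow_pos hlog 2
  -- identify the rung count at depth u with the layer's count
  have hcount : #((Icc 1 x).filter (fun n : ℕ => ∀ i, 0 < (twinSystem i).eval (n : ℤ) ∧
      ∀ p ∈ range ⌈(x : ℝ) ^ (((twinSystem i).natDegree : ℝ) / u)⌉₊,
        p.Prime → ¬ ((p : ℤ) ∣ (twinSystem i).eval (n : ℤ)))) =
    #((Icc 1 x).filter (fun n : ℕ => ∀ i, 0 < (twinSystem i).eval (n : ℤ) ∧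
      ∀ p ∈ range ⌈(x : ℝ) ^ (((twinSystem i).natDegree : ℝ) * (1 - δ) / 2)⌉₊,
        p.Prime → ¬ ((p : ℤ) ∣ (twinSystem i).eval (n : ℤ)))) := by
    congr 1; ext n; simp only [mem_filter, hexp]
  set Φ : ℝ := (#((Icc 1 x).filter (fun n : ℕ => ∀ i, 0 < (twinSystem i).eval (n : ℤ) ∧
      ∀ p ∈ range ⌈(x : ℝ) ^ (((twinSystem i).natDegree : ℝ) * (1 - δ) / 2)⌉₊,
        p.Prime → ¬ ((p : ℤ) ∣ (twinSystem i).eval (n : ℤ)))) : ℝ) with hΦ_def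
  have hratio : ratio twinSystem u x = Φ * Real.log x ^ 2 / x := by
    unfold ratio; rw [hcount]
  -- from the lower half: Φ (log x)²/x ≥ C₀ (uω)² − C₀/4 ≥ 3C₀/4
  have hΦ : 3 * C₀ / 4 ≤ Φ * Real.log x ^ 2 / x := by
    rw [← hratio]
    have : C₀ ≤ C₀ * (u * buchstabOmega u) ^ 2 := by nlinarith
    linarith
  -- from the layer: P ≥ Φ − (C₀/4) x/(log x)²
  have hP : Φ - C₀ / 4 * x / Real.log x ^ 2 ≤ (polyPrimeCount twinSystem x : ℝ) := by linarith
  rw [polyPrimeCount_twinSystem] at hP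
  -- combine
  have h1 : 3 * C₀ / 4 * (x / Real.log x ^ 2) ≤ Φ := by
    have := mul_le_mul_of_nonneg_right hΦ (show (0 : ℝ) ≤ x / Real.log x ^ 2 by positivity)
    have h2 : Φ * Real.log x ^ 2 / x * (x / Real.log x ^ 2) = Φ := by field_simp
    linarith
  have h3 : C₀ / 4 * x / Real.log x ^ 2 = C₀ / 4 * (x / Real.log x ^ 2) := by ring
  rw [h3] at hP
  linarith

/-- WHY LEAF U IS BEYOND EVERY UPPER-BOUND SIEVE (kernel-checked): the UPPER half alone gives, for
every Bateman–Horn system of every degree, the factor-ONE upper bound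
`P_f(x) ≤ (C(f)/∏ deg fᵢ + ε)·x/(log x)^k` eventually (the parity floor of upper-bound sieves is the
factor 2).  Upper half of the squeeze: `P_f ≤ Φ_f(x, 2/(1−δ)) + K + k(2√x+1)` (PROVED, all degrees,
`polyPrimeCount_le_cruxCount_add`) and `(uω(u))^k = (1 + log((1+δ)/(1−δ)))^k ↓ 1`. [folklore] -/
theorem sharpUpper_of_upperRVL (hUp : UpperRVL) {k : ℕ} {f : Fin k → ℤ[X]}
    (hf : IsBatemanHornSystem f) :
    ∀ ε : ℝ, 0 < ε → ∀ᶠ x : ℕ in atTop,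
      (polyPrimeCount f x : ℝ) ≤ (bhA f + ε) * x / Real.log x ^ k := by
  intro ε hε
  set C₀ : ℝ := bhA f with hC₀_def
  have hD0 : (0 : ℝ) < ∏ i, ((f i).natDegree : ℝ) :=
    prod_pos fun i _ => by exact_mod_cast hf.natDegree_pos i
  obtain ⟨-, hCf0⟩ := IsBatemanHornSystem.hasBatemanHornConst_holds hf
  have hC₀0 : 0 < C₀ := by rw [hC₀_def]; unfold bhA; exact div_pos hCf0 hD0
  -- choose δ with C₀ (1 + log((1+δ)/(1−δ)))^k < C₀ + ε/3 (continuity at δ = 0)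
  have hφc : ContinuousAt (fun δ : ℝ => C₀ * (1 + Real.log ((1 + δ) / (1 - δ))) ^ k) 0 := by
    fun_prop (disch := norm_num)
  have hevφ : ∀ᶠ δ : ℝ in 𝓝 0, C₀ * (1 + Real.log ((1 + δ) / (1 - δ))) ^ k < C₀ + ε / 3 := by
    have := hφc.tendsto
    simp only [add_zero, sub_zero, div_one, Real.log_one, one_pow, mul_one] at this
    exact this.eventually (eventually_lt_nhds (by linarith))
  obtain ⟨r, hr, hrφ⟩ := Metric.eventually_nhds_iff.mp hevφ
  obtain ⟨δ, hδ_def⟩ : ∃ δ : ℝ, δ = min (1 / 4) (r / 2) := ⟨_, rfl⟩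
  have hδ0 : 0 < δ := by rw [hδ_def]; positivity
  have hδ4 : δ ≤ 1 / 4 := by rw [hδ_def]; exact min_le_left _ _
  have hδr : δ < r := by
    rw [hδ_def]; exact lt_of_le_of_lt (min_le_right _ _) (by linarith)
  have hφδ : C₀ * (1 + Real.log ((1 + δ) / (1 - δ))) ^ k < C₀ + ε / 3 :=
    hrφ (by rw [Real.dist_eq, sub_zero, abs_of_pos hδ0]; exact hδr)
  -- the depth u = 2/(1−δ) ∈ (2,3] and the value of the Buchstab factor there
  obtain ⟨u, hu_def⟩ : ∃ u : ℝ, u = 2 / (1 - δ) := ⟨_, rfl⟩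
  have h1δ : 0 < 1 - δ := by linarith
  have hu2 : 2 < u := by rw [hu_def, lt_div_iff₀ h1δ]; linarith
  have hu3 : u ≤ 3 := by rw [hu_def, div_le_iff₀ h1δ]; linarith
  have hexp : ∀ d : ℕ, (d : ℝ) / u = (d : ℝ) * (1 - δ) / 2 := by
    intro d; rw [hu_def]; field_simp
  have hval : (u * buchstabOmega u) ^ k = (1 + Real.log ((1 + δ) / (1 - δ))) ^ k := by
    rw [buchstabOmega_eq_of_mem_Icc_two_three hu2.le hu3]
    have hu0 : u ≠ 0 := by linarith
    have h1 : u - 1 = (1 + δ) / (1 - δ) := by rw [hu_def]; field_simp; ring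
    rw [mul_div_cancel₀ _ hu0, h1]
  -- upper half at (f, buchstabOmega, u, ε/3)
  have hup := hUp k f hf buchstabOmega isBuchstab_buchstabOmega u hu2 (ε / 3) (by positivity)
  -- P_f ≤ Φ + K + k(2√x+1), remainder negligible
  obtain ⟨K, hK⟩ :=
    Summit.Parity.BatemanHorn.Theorems.BalancedSemiprimeLayer.Negative.polyPrimeCount_le_cruxCount_add
      f hf.leadingCoeff_pos hf.natDegree_pos hδ0.le
  have hrem := Summit.Parity.BatemanHorn.Theorems.RoughValueTransportAssembly.tendsto_remainder K k
  filter_upwards [hup, hrem.eventually (eventually_lt_nhds (show (0 : ℝ) < ε / 3 by positivity)),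
    eventually_gt_atTop 1] with x hx hxrem hx1
  have hx' : (1 : ℝ) < x := by exact_mod_cast hx1
  have hlog : 0 < Real.log x := Real.log_pos hx'
  have hx0 : (0 : ℝ) < x := by linarith
  have hpow : 0 < Real.log x ^ k := pow_pos hlog k
  -- identify the rung count at depth u with the count sifted to x^{deg(1−δ)/2}
  have hcount : #((Icc 1 x).filter (fun n : ℕ => ∀ i, 0 < (f i).eval (n : ℤ) ∧
      ∀ p ∈ range ⌈(x : ℝ) ^ (((f i).natDegree : ℝ) / u)⌉₊,
        p.Prime → ¬ ((p : ℤ) ∣ (f i).eval (n : ℤ)))) =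
    #((Icc 1 x).filter (fun n : ℕ => ∀ i, 0 < (f i).eval (n : ℤ) ∧
      ∀ p ∈ range ⌈(x : ℝ) ^ (((f i).natDegree : ℝ) * (1 - δ) / 2)⌉₊,
        p.Prime → ¬ ((p : ℤ) ∣ (f i).eval (n : ℤ)))) := by
    congr 1; ext n; simp only [mem_filter, hexp]
  set Φ : ℝ := (#((Icc 1 x).filter (fun n : ℕ => ∀ i, 0 < (f i).eval (n : ℤ) ∧
      ∀ p ∈ range ⌈(x : ℝ) ^ (((f i).natDegree : ℝ) * (1 - δ) / 2)⌉₊,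
        p.Prime → ¬ ((p : ℤ) ∣ (f i).eval (n : ℤ)))) : ℝ) with hΦ_def
  have hratio : ratio f u x = Φ * Real.log x ^ k / x := by
    unfold ratio; rw [hcount]
  -- normalised bound: P (log x)^k / x ≤ Φ (log x)^k/x + rem < (C₀ + ε/3 + ε/3) + ε/3
  have hΦle : Φ * Real.log x ^ k / x ≤ C₀ + ε / 3 + ε / 3 := by
    rw [← hratio]
    have : bhA f * (u * buchstabOmega u) ^ k < C₀ + ε / 3 := by rw [hval]; exact hφδ
    linarith
  have hnorm : (polyPrimeCount f x : ℝ) * Real.log x ^ k / x ≤ C₀ + ε := by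
    have key : ∀ P R : ℝ, P ≤ Φ + K + R →
        P * Real.log x ^ k / x ≤ Φ * Real.log x ^ k / x + (K + R) * Real.log x ^ k / x := by
      intro P R h
      have h1 : P * Real.log x ^ k / x ≤ (Φ + K + R) * Real.log x ^ k / x :=
        div_le_div_of_nonneg_right (mul_le_mul_of_nonneg_right h hpow.le) hx0.le
      have h2 : (Φ + K + R) * Real.log x ^ k / x =
          Φ * Real.log x ^ k / x + (K + R) * Real.log x ^ k / x := by ring
      linarith
    have := key _ _ (hK x)
    linarith
  -- un-normalise
  have h1 : (polyPrimeCount f x : ℝ) * Real.log x ^ k / x * (x / Real.log x ^ k) =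
      (polyPrimeCount f x : ℝ) := by
    field_simp
  have h2 : (C₀ + ε) * (x / Real.log x ^ k) = (C₀ + ε) * x / Real.log x ^ k := by ring
  have hxq : 0 < (x : ℝ) / Real.log x ^ k := div_pos hx0 hpow
  calc (polyPrimeCount f x : ℝ)
      = (polyPrimeCount f x : ℝ) * Real.log x ^ k / x * (x / Real.log x ^ k) := h1.symm
    _ ≤ (C₀ + ε) * (x / Real.log x ^ k) := mul_le_mul_of_nonneg_right hnorm hxq.le
    _ = (C₀ + ε) * x / Real.log x ^ k := h2

/-! ### §S-A — the multi-depth strengthening (independent depths per coordinate) -/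

/-- The normalised count with an independent value-depth `uᵢ` per coordinate. -/
def ratioMulti {k : ℕ} (f : Fin k → ℤ[X]) (u : Fin k → ℝ) (x : ℕ) : ℝ :=
  (((Finset.Icc 1 x).filter (fun n : ℕ => ∀ i, 0 < (f i).eval (n : ℤ) ∧
    ∀ p ∈ Finset.range ⌈(x : ℝ) ^ (((f i).natDegree : ℝ) / u i)⌉₊,
      p.Prime → ¬ ((p : ℤ) ∣ (f i).eval (n : ℤ)))).card : ℝ) * Real.log x ^ k / (x : ℝ)

/-- S⁺ (multi-depth product law): one constant, PRODUCT shape `∏ᵢ uᵢω(uᵢ)` in the independent depths. -/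
def MultiDepthRVL : Prop :=
  ∀ (k : ℕ) (f : Fin k → ℤ[X]), IsBatemanHornSystem f → ∀ ω, IsBuchstab ω →
    ∃ A : ℝ, ∀ u : Fin k → ℝ, (∀ i, 2 < u i) →
      Tendsto (ratioMulti f u) atTop (𝓝 (A * ∏ i, (u i * ω (u i))))

/-- The diagonal `uᵢ ≡ u` of S⁺ is the crux. -/
theorem roughValueLaw_of_multiDepth (h : MultiDepthRVL) : RoughValueLaw := by
  rw [roughValueLaw_iff]
  intro k f hf ω hω
  obtain ⟨A, hA⟩ := h k f hf ω hω
  refine ⟨A, fun u hu => ?_⟩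
  have key := hA (fun _ => u) (fun _ => hu)
  have hfun : ratioMulti f (fun _ => u) = ratio f u := by
    funext x; simp only [ratioMulti, ratio]
  have hprod : (∏ _i : Fin k, (u * ω u)) = (u * ω u) ^ k := by
    rw [Finset.prod_const, Finset.card_univ, Fintype.card_fin]
  rw [hfun, hprod] at key
  exact key

/-! ### §D9 — the Tauberian split in `t = log log x` (typed only) -/

/-- Leaf M: the log-log Cesàro mean of the normalised count has the Buchstab value
(weights `1/(x log x)`, total mass `∼ log log N`). -/
def LogLogMeanRVL : Prop :=
  ∀ (k : ℕ) (f : Fin k → ℤ[X]), IsBatemanHornSystem f → ∀ ω, IsBuchstab ω → ∀ u : ℝ, 2 < u →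
    Tendsto (fun N : ℕ => (∑ x ∈ Finset.Icc 2 N, ratio f u x / ((x : ℝ) * Real.log x)) /
      Real.log (Real.log N)) atTop (𝓝 (bhA f * (u * ω u) ^ k))

/-- Leaf R: no conspiracy across POWER scales — slow oscillation of the normalised count in the
variable `log log x` (`x ≤ y ≤ x^{1+δ}`). -/
def PowerScaleRegular : Prop :=
  ∀ (k : ℕ) (f : Fin k → ℤ[X]), IsBatemanHornSystem f → ∀ u : ℝ, 2 < u → ∀ ε : ℝ, 0 < ε →
    ∃ δ : ℝ, 0 < δ ∧ ∀ᶠ x : ℕ in atTop, ∀ y : ℕ, x ≤ y → (y : ℝ) ≤ (x : ℝ) ^ (1 + δ) →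
      |ratio f u y - ratio f u x| ≤ ε

/-- The §D9 glue, as a statement (R. Schmidt's slow-oscillation Tauberian theorem in the variable
`t = log log x`: Cesàro-convergent in `t` + slowly oscillating in `t` ⇒ convergent); recorded, not
formalised in this companion. -/
def TauberGlue : Prop := LogLogMeanRVL → PowerScaleRegular → RoughValueLaw

end Summit.Parity.BatemanHorn.Cruxes.RoughValueLaw.CensusS1

end
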